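import Mathlib
import Summits.Ventures.PercRepro2.Defs
import Summits.Ventures.PercRepro2.Independence
import Summits.Ventures.PercRepro2.Harris
import Summits.Ventures.PercRepro2.Graph
import Summits.Ventures.PercRepro2.Exploration
import Summits.Ventures.PercRepro2.Events
import Summits.Ventures.PercRepro2.FourFunctions
import Summits.Ventures.PercRepro2.Induced
import Summits.Ventures.PercRepro2.Frontier
import Summits.Ventures.PercRepro2.ObsIndependence
import Summits.Ventures.PercRepro2.BHK
import Summits.Ventures.PercRepro2.BHKEvents
import Summits.Ventures.PercRepro2.BHKAvoid
import Summits.Ventures.PercRepro2.SameClusterAvoid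
import Summits.Ventures.PercRepro2.CaseOneRegime
import Summits.Ventures.PercRepro2.CaseOnePos
import Summits.Ventures.PercRepro2.CaseOneJ11
import Summits.Ventures.PercRepro2.CaseOneRV
import Summits.Ventures.PercRepro2.PathMixBHK
import Summits.Ventures.PercRepro2.CylinderCond
import Summits.Ventures.PercRepro2.CylinderCov
import Summits.Ventures.PercRepro2.PathMixKernel
import Summits.Ventures.PercRepro2.Explore
import Summits.Ventures.PercRepro2.PathMixBridge
import Summits.Ventures.PercRepro2.ExploreHalt
import Summits.Ventures.PercRepro2.ExploreHaltDecides

/-!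
# PATHMIX for the canonical exploration: `PM ≥ 0 ⟹ (ii) ⟹ (RV)` on the records of the `a₁`-rooted
exploration halted when `a₃` joins (blind cell PercRepro2, p1 g13; ASSIGNMENTS v12.50 (4) «so that
`rv_of_pm` becomes unconditional modulo `pmExpr ≥ 0`»)

`Explore.haltRule sel a₁ a₃` (ExploreHalt.lean; `sel` = BFS, DFS or any fixed edge order) decides
`{a₃ ∈ C₁}` (`haltRule_decides`), so its case-1 records `canonRecords` are a cylinder partition of
`{a₃ ∈ C₁}` (**`isCylinderPartition_canonRecords`**) and `PathMix.rv_of_pm_rule` applies: with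
**`canonPM := pmExpr (canonRecords)`** — the lead's PM, p1's `(PATH_{−π′_b})`, the quantity of the
census (0 / 23,463,168 per palette at the exhaustive n = 6 bar, DFS records) —
**`zSplitII_of_canonPM`**: `0 ≤ canonPM ⟹ (ii)` and **`rv_of_canonPM`**: `0 ≤ canonPM ⟹ (RV)`, under
`P(Q), D, M, P(T′) > 0`. Every hypothesis except `0 ≤ canonPM` is a positivity of an event mass; the
conjecture `PM ≥ 0` itself is not claimed. -/

namespace Summit.Ventures.PercRepro2

namespace PathMix

open Explore CylinderCond CylinderCov

section Canonical
variable {V : Type*} {E : Type*} [Fintype E] [DecidableEq E] [Fintype V] [DecidableEq V]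
  {ends : E → Sym2 V}

/-- The case-1 records of the halted exploration with selector `sel`. -/
noncomputable def canonRecords (sel : Selector ends) (a₁ a₃ : V) : Finset (Record E) :=
  caseOneRecords (haltRule sel a₁ a₃) ends a₁ a₃

/-- The canonical records partition `{a₃ ∈ C₁}` into cylinders. -/
theorem isCylinderPartition_canonRecords (sel : Selector ends) (a₁ a₃ : V) :
    IsCylinderPartition (canonRecords sel a₁ a₃) Record.explored recSigma (connEvent ends a₁ a₃) := by
  classical
  exact isCylinderPartition_records (haltRule sel a₁ a₃) (connEvent ends a₁ a₃)
    (haltRule_decides sel a₁ a₃)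

variable {R : Type*} [Field R] [LinearOrder R] [IsStrictOrderedRing R]

/-- **The lead's PM on the canonical records**: `Σ_T w_T (P_Q(b ∈ C₂) − x_T / m_T)(γ − y_T / m_T)`. -/
noncomputable def canonPM (sel : Selector ends) (p : E → R) (o a₁ a₂ a₃ b : V) : R :=
  pmExpr p ends o a₁ a₂ a₃ b (canonRecords sel a₁ a₃) Record.explored recSigma

/-- **`PM ≥ 0 ⟹ (ii)` for the canonical exploration.** -/
theorem zSplitII_of_canonPM (sel : Selector ends) (p : E → R) (hp : IsProbVec p) (o a₁ a₂ a₃ b : V)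
    (hQ : 0 < prob p (connEvent ends a₁ a₂)ᶜ) (hD : 0 < CaseOne.Dpd p ends a₁ a₂ a₃)
    (hM : 0 < ∑ T ∈ canonRecords sel a₁ a₃,
      recC p Record.explored recSigma T * recM p ends a₁ a₂ Record.explored recSigma T)
    (hpm : 0 ≤ canonPM sel p o a₁ a₂ a₃ b) : CaseOne.ZSplitII p ends o a₁ a₂ a₃ b :=
  zSplitII_of_pm_rule (haltRule sel a₁ a₃) p hp ends o a₁ a₂ a₃ b (haltRule_decides sel a₁ a₃) hQ hD
    hM hpm

/-- **`PM ≥ 0 ⟹ (RV)` for the canonical exploration** (the required-vertex world of positive mass). -/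
theorem rv_of_canonPM (sel : Selector ends) (p : E → R) (hp : IsProbVec p) (o a₁ a₂ a₃ b : V)
    (hQ : 0 < prob p (connEvent ends a₁ a₂)ᶜ) (hD : 0 < CaseOne.Dpd p ends a₁ a₂ a₃)
    (hM : 0 < ∑ T ∈ canonRecords sel a₁ a₃,
      recC p Record.explored recSigma T * recM p ends a₁ a₂ Record.explored recSigma T)
    (hT : 0 < prob p (CaseOne.Tp ends a₁ a₂ a₃)) (hpm : 0 ≤ canonPM sel p o a₁ a₂ a₃ b) :
    CaseOne.RV p ends o a₁ a₂ a₃ b :=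
  rv_of_pm_rule (haltRule sel a₁ a₃) p hp ends o a₁ a₂ a₃ b (haltRule_decides sel a₁ a₃) hQ hD hM hT
    hpm

end Canonical

end PathMix

end Summit.Ventures.PercRepro2
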